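import Mathlib
import Summits.KontsevichZagierPeriods.Zeta5Search.CatalanTwoAdicXi
import Summits.KontsevichZagierPeriods.Zeta5Search.CatalanTwoAdicAtoms
import Summits.KontsevichZagierPeriods.Zeta5Search.CatalanTwoAdicFactorialSeries
import HarnessLib

/-!
# Catalan box family — kernel K5b: `8ξ = −Θ₂(½) = Σ_{k≥1} G_k(−2)^{k+1}` in `ℚ₂` (step 3 of 3: specialisation at `x = ½`)

HONEST FRAMING: systematic search; no irrationality claim unless certified.

Cell `pub-zeta5`, seat `fam-catalan` (generation 4), successor project "kernel K5b" (`families/denom/K5B.md` §3 Lemma B, §7).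
The lane's 2-adic constant is `ξ := ⅛ Σ'_μ t_μ/(μ+½) ∈ ℚ₂` (`CatalanTwoAdicXi.xi`, `hasSum_xi`).  Step 2
(`CatalanTwoAdicFactorialSeries`) proved the identity of formal power series in `X = 1/x`
  `Σ_n â_n = Φ := Σ_k G_k (−1)^{k+1} X^{k+1}`            (`AHat_eq_Phi`, coefficientwise `sum_coeff_aHat`),
where `â_n(X)` is the expansion of `a_n(x) = n!/((x)_{n+1}(x+n))` and `G_k = 2(1−2^k)B_k` are the Genocchi numbers.  Here we
evaluate at `X = 2` (`x = ½`) in `ℚ₂`: `ev F := Σ'_N [X^N]F·2^N`, multiplicative on TAME series (`‖[X^N]F·2^N‖₂ ≤ 2^{−N}`, closed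
under products by the ultrametric inequality); `ev(â_n) = n!·2^{n+2}/((2n+1)·3·5⋯(2n+1)) = t_n/(n+½)` (`hasSum_evTerm_aHat`); the double
family `(N,n) ↦ [X^N]â_n·2^N` is absolutely summable, so summing over `n` first (finite, `= φ_N 2^N`) and over `N` first (`= Σ_n t_n/(n+½) = 8ξ`)
gives `Σ_N φ_N 2^N = 8ξ`, i.e.

  `8·ξ = Σ_{k≥0} G_k·(−2)^{k+1} = −Σ_{k≥0} (2^{k+1}−2)·B_k·(−2)^{k+1}`   (`hasSum_genocchi`, `eight_mul_xi_eq_neg_tsum_bernoulli`).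

The right-hand side is `−Θ₂(½)` for Beukers' `Θ(x) = Σ_k (2^{k+1}−2)B_k(−1/x)^{k+1}` ([Be08, §5, p = 2]); by [Be08, Prop. 9 /
Cor. 8(iii)] `Θ₂(½) = −8ζ₂(2)` (Kubota–Leopoldt), which is the paper-grade second link of (C6) and is NOT claimed here.  No 2-adic
estimate of Bernoulli numbers is used: summability of the Genocchi series comes out of the rearrangement.  0 sorry.
-/

open Finset PowerSeries Nat

noncomputable section

namespace Summit.KontsevichZagierPeriods.Zeta5Search.CatalanTwoAdicTheta

open CatalanTwoAdicSeries (tB tB_zero tB_succ xiTerm xi hasSum_xi norm_two_padic)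
open CatalanTwoAdicGenocchi (genocchi)
open CatalanTwoAdicFactorialSeries (geomInv coeff_geomInv gProd gProd_zero gProd_succ aHat coeff_aHat_of_lt natCast_eq_C
  phiCoeff phiCoeff_zero phiCoeff_succ sum_coeff_aHat)

/-! ### Evaluation at `X = 2` in `ℚ₂` and tame series -/

/-- The `N`-th term of the evaluation of `F ∈ ℚ⟦X⟧` at `X = 2` in `ℚ₂`: `[X^N]F · 2^N`. -/
def evTerm (F : ℚ⟦X⟧) (N : ℕ) : ℚ_[2] := ((coeff N F : ℚ) : ℚ_[2]) * 2 ^ N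

/-- `ev F := Σ'_N [X^N]F · 2^N ∈ ℚ₂`, the value of `F` at `X = 2`, i.e. at `x = 1/X = ½` (meaningful for tame `F`). -/
def ev (F : ℚ⟦X⟧) : ℚ_[2] := ∑' N, evTerm F N

/-- Tameness: `‖[X^N]F · 2^N‖₂ ≤ 2^{−N}` for all `N`. -/
def Tame (F : ℚ⟦X⟧) : Prop := ∀ N, ‖evTerm F N‖ ≤ ((1 : ℝ) / 2) ^ N

/-- A tame series is absolutely summable at `X = 2`. -/
theorem Tame.summable_norm {F : ℚ⟦X⟧} (h : Tame F) : Summable fun N => ‖evTerm F N‖ :=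
  Summable.of_nonneg_of_le (fun _ => norm_nonneg _) h summable_geometric_two

/-- A tame series sums to its value `ev F`. -/
theorem Tame.hasSum {F : ℚ⟦X⟧} (h : Tame F) : HasSum (evTerm F) (ev F) :=
  h.summable_norm.of_norm.hasSum

/-- `‖2^N‖₂ = 2^{−N}`. -/
theorem norm_two_pow (N : ℕ) : ‖(2 : ℚ_[2]) ^ N‖ = ((1 : ℝ) / 2) ^ N := by rw [norm_pow, norm_two_padic]

/-- Terms of a product: `evTerm (FG) N = Σ_{i+j=N} evTerm F i · evTerm G j`. -/
theorem evTerm_mul (F G : ℚ⟦X⟧) (N : ℕ) :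
    evTerm (F * G) N = ∑ p ∈ antidiagonal N, evTerm F p.1 * evTerm G p.2 := by
  rw [evTerm, coeff_mul, Rat.cast_sum, sum_mul]
  refine sum_congr rfl fun p hp => ?_
  rw [evTerm, evTerm, ← mem_antidiagonal.mp hp, pow_add, Rat.cast_mul]
  ring

/-- Tame series are closed under products (ultrametric inequality). -/
theorem Tame.mul {F G : ℚ⟦X⟧} (hF : Tame F) (hG : Tame G) : Tame (F * G) := by
  intro N
  rw [evTerm_mul]
  refine IsUltrametricDist.norm_sum_le_of_forall_le_of_nonneg (by positivity) fun p hp => ?_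
  rw [norm_mul, ← mem_antidiagonal.mp hp, pow_add]
  exact mul_le_mul (hF p.1) (hG p.2) (norm_nonneg _) (by positivity)

/-- `ev` is multiplicative on tame series (Cauchy product of absolutely convergent series). -/
theorem ev_mul {F G : ℚ⟦X⟧} (hF : Tame F) (hG : Tame G) : ev (F * G) = ev F * ev G := by
  unfold ev
  rw [tsum_mul_tsum_eq_tsum_sum_antidiagonal_of_summable_norm hF.summable_norm hG.summable_norm]
  exact tsum_congr fun N => evTerm_mul F G N

/-- Terms of `1`. -/
theorem evTerm_one (N : ℕ) : evTerm 1 N = if N = 0 then 1 else 0 := by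
  rw [evTerm, coeff_one]; split_ifs with h <;> simp [h]

/-- `1` is tame. -/
theorem tame_one : Tame 1 := by
  intro N; rw [evTerm_one]; split_ifs with h
  · subst h; simp
  · rw [norm_zero]; positivity

/-- `ev 1 = 1`. -/
theorem ev_one : ev 1 = 1 := by
  rw [ev, tsum_eq_single 0 (fun N hN => by rw [evTerm_one, if_neg hN]), evTerm_one, if_pos rfl]

/-- Finite products of tame series are tame. -/
theorem Tame.prod_range {f : ℕ → ℚ⟦X⟧} (h : ∀ i, Tame (f i)) (n : ℕ) : Tame (∏ i ∈ range n, f i) := by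
  induction n with
  | zero => simpa using tame_one
  | succ n ih => rw [prod_range_succ]; exact ih.mul (h n)

/-- `ev` of a finite product of tame series. -/
theorem ev_prod_range {f : ℕ → ℚ⟦X⟧} (h : ∀ i, Tame (f i)) (n : ℕ) :
    ev (∏ i ∈ range n, f i) = ∏ i ∈ range n, ev (f i) := by
  induction n with
  | zero => simpa using ev_one
  | succ n ih => rw [prod_range_succ, prod_range_succ, ev_mul (Tame.prod_range h n) (h n), ih]

/-- Terms of `X^k`. -/
theorem evTerm_X_pow (k N : ℕ) : evTerm (X ^ k) N = if N = k then 2 ^ k else 0 := by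
  rw [evTerm, coeff_X_pow]; split_ifs with h <;> simp [h]

/-- `X^k` is tame. -/
theorem tame_X_pow (k : ℕ) : Tame (X ^ k) := by
  intro N; rw [evTerm_X_pow]; split_ifs with h
  · subst h; exact (norm_two_pow _).le
  · rw [norm_zero]; positivity

/-- `ev X^k = 2^k`. -/
theorem ev_X_pow (k : ℕ) : ev (X ^ k) = 2 ^ k := by
  rw [ev, tsum_eq_single k (fun N hN => by rw [evTerm_X_pow, if_neg hN]), evTerm_X_pow, if_pos rfl]

/-- Terms of `g_i`: `(−2i)^N`. -/
theorem evTerm_geomInv (i N : ℕ) : evTerm (geomInv i) N = (-(2 * (i : ℚ_[2]))) ^ N := by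
  rw [evTerm, coeff_geomInv, Rat.cast_pow, ← mul_pow]; push_cast; ring

/-- `‖2i‖₂ ≤ ½`. -/
theorem norm_two_mul_natCast_le (i : ℕ) : ‖-(2 * (i : ℚ_[2]))‖ ≤ (1 : ℝ) / 2 := by
  rw [norm_neg, norm_mul, norm_two_padic]
  exact mul_le_of_le_one_right (by norm_num) (IsUltrametricDist.norm_natCast_le_one ℚ_[2] i)

/-- `g_i` is tame. -/
theorem tame_geomInv (i : ℕ) : Tame (geomInv i) := by
  intro N; rw [evTerm_geomInv, norm_pow]
  exact pow_le_pow_left₀ (norm_nonneg _) (norm_two_mul_natCast_le i) N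

/-- **`g_i(2) = 1/(1+2i)`** (geometric series in `ℚ₂`; this is `x/(x+i)` at `x = ½`). -/
theorem ev_geomInv (i : ℕ) : ev (geomInv i) = (1 + 2 * (i : ℚ_[2]))⁻¹ := by
  have h : ‖-(2 * (i : ℚ_[2]))‖ < 1 := (norm_two_mul_natCast_le i).trans_lt (by norm_num)
  have hs := hasSum_geometric_of_norm_lt_one h
  rw [ev, show evTerm (geomInv i) = fun N => (-(2 * (i : ℚ_[2]))) ^ N from funext (evTerm_geomInv i), hs.tsum_eq,
    sub_neg_eq_add]

/-! ### The value of `â_n` at `X = 2` is `t_n/(n+½)` -/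

/-- The tame part of `â_n`: `X^{n+2}·g_n·P_n`. -/
def aCore (n : ℕ) : ℚ⟦X⟧ := X ^ (n + 2) * (geomInv n * gProd n)

/-- `â_n = n!·aCore_n`. -/
theorem aHat_eq (n : ℕ) : aHat n = (n ! : ℚ⟦X⟧) * aCore n := by
  rw [aHat, aCore, mul_assoc]

/-- `P_n` is tame. -/
theorem tame_gProd (n : ℕ) : Tame (gProd n) := by
  unfold gProd; exact Tame.prod_range (fun i => tame_geomInv (i + 1)) n

/-- `P_n(2) = ∏_{i<n} 1/(2i+3)`. -/
theorem ev_gProd (n : ℕ) : ev (gProd n) = ∏ i ∈ range n, (1 + 2 * ((i : ℚ_[2]) + 1))⁻¹ := by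
  unfold gProd
  rw [ev_prod_range (fun i => tame_geomInv (i + 1))]
  exact prod_congr rfl fun i _ => by rw [ev_geomInv]; push_cast; ring

/-- `aCore_n` is tame. -/
theorem tame_aCore (n : ℕ) : Tame (aCore n) :=
  (tame_X_pow _).mul ((tame_geomInv n).mul (tame_gProd n))

/-- `aCore_n(2) = 2^{n+2}/((2n+1)·3·5⋯(2n+1))`. -/
theorem ev_aCore (n : ℕ) :
    ev (aCore n) = 2 ^ (n + 2) * ((1 + 2 * (n : ℚ_[2]))⁻¹ * ∏ i ∈ range n, (1 + 2 * ((i : ℚ_[2]) + 1))⁻¹) := by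
  rw [aCore, ev_mul (tame_X_pow _) ((tame_geomInv n).mul (tame_gProd n)), ev_X_pow,
    ev_mul (tame_geomInv n) (tame_gProd n), ev_geomInv, ev_gProd]

/-- Terms of `â_n` at `X = 2`. -/
theorem evTerm_aHat (n N : ℕ) : evTerm (aHat n) N = (n ! : ℚ_[2]) * evTerm (aCore n) N := by
  rw [aHat_eq, evTerm, evTerm, natCast_eq_C, coeff_C_mul]; push_cast; ring

/-- Closed form of the general term: `t_n/(n+½) = n!·2^{n+2}/((2n+1)·3·5⋯(2n+1))`. -/
theorem xiTerm_eq (n : ℕ) :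
    xiTerm n = (n ! : ℚ) * (2 ^ (n + 2) * ((1 + 2 * (n : ℚ))⁻¹ * ∏ i ∈ range n, (1 + 2 * ((i : ℚ) + 1))⁻¹)) := by
  have htB : ∀ m : ℕ, tB m = 2 ^ (m + 1) * (m ! : ℚ) * ∏ i ∈ range m, (1 + 2 * ((i : ℚ) + 1))⁻¹ := by
    intro m
    induction m with
    | zero => rw [tB_zero]; simp
    | succ m ih =>
      rw [tB_succ, ih, prod_range_succ, Nat.factorial_succ]
      have h1 : (2 : ℚ) * m + 3 ≠ 0 := by positivity
      have h2 : (1 : ℚ) + 2 * ((m : ℚ) + 1) ≠ 0 := by positivity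
      push_cast
      field_simp
      ring
  rw [xiTerm, htB]
  have h3 : (n : ℚ) + 1 / 2 ≠ 0 := by positivity
  have h4 : (1 : ℚ) + 2 * (n : ℚ) ≠ 0 := by positivity
  field_simp
  ring

/-- **`â_n(2) = t_n/(n+½)`:** the value of `â_n` at `X = 2` (`x = ½`) is the general term of the series `8ξ = Σ_μ t_μ/(μ+½)`. -/
theorem hasSum_evTerm_aHat (n : ℕ) : HasSum (evTerm (aHat n)) ((xiTerm n : ℚ) : ℚ_[2]) := by
  have h := (tame_aCore n).hasSum.mul_left (n ! : ℚ_[2])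
  rw [ev_aCore] at h
  have e : ((xiTerm n : ℚ) : ℚ_[2]) =
      (n ! : ℚ_[2]) * (2 ^ (n + 2) * ((1 + 2 * (n : ℚ_[2]))⁻¹ * ∏ i ∈ range n, (1 + 2 * ((i : ℚ_[2]) + 1))⁻¹)) := by
    rw [xiTerm_eq]; push_cast; ring
  rw [e, show evTerm (aHat n) = fun N => (n ! : ℚ_[2]) * evTerm (aCore n) N from funext (evTerm_aHat n)]
  exact h

/-! ### Summing the double family `(N, n) ↦ [X^N]â_n·2^N` in either order -/

/-- Domination: `‖[X^N]â_n·2^N‖₂ ≤ [n+2 ≤ N]·2^{−N}`. -/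
theorem norm_evTerm_aHat_le (n N : ℕ) :
    ‖evTerm (aHat n) N‖ ≤ if n + 2 ≤ N then ((1 : ℝ) / 2) ^ N else 0 := by
  split_ifs with h
  · rw [evTerm_aHat, norm_mul]
    calc ‖(n ! : ℚ_[2])‖ * ‖evTerm (aCore n) N‖ ≤ 1 * ((1 : ℝ) / 2) ^ N :=
          mul_le_mul (IsUltrametricDist.norm_natCast_le_one ℚ_[2] _) (tame_aCore n N) (norm_nonneg _) zero_le_one
      _ = ((1 : ℝ) / 2) ^ N := one_mul _
  · rw [evTerm, coeff_aHat_of_lt (not_le.mp h), Rat.cast_zero, zero_mul, norm_zero]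

/-- The dominating family is summable: `Σ_N (N−1)·2^{−N} < ∞`. -/
theorem summable_bound : Summable fun p : ℕ × ℕ => if p.2 + 2 ≤ p.1 then ((1 : ℝ) / 2) ^ p.1 else 0 := by
  have hnn : (0 : ℕ × ℕ → ℝ) ≤ fun p => if p.2 + 2 ≤ p.1 then ((1 : ℝ) / 2) ^ p.1 else 0 := by
    intro p; simp only [Pi.zero_apply]; split_ifs <;> positivity
  have hr : ‖(1 : ℝ) / 2‖ < 1 := by rw [Real.norm_eq_abs, abs_of_pos (by norm_num)]; norm_num
  refine (summable_prod_of_nonneg hnn).mpr ⟨fun N => ?_, ?_⟩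
  · exact summable_of_ne_finset_zero (s := range N) fun n hn =>
      if_neg (show ¬ (n + 2 ≤ N) by rw [mem_range] at hn; omega)
  · refine Summable.of_nonneg_of_le (fun N => tsum_nonneg fun n => ?_) (fun N => ?_)
      (summable_pow_mul_geometric_of_norm_lt_one 1 hr)
    · dsimp only; split_ifs <;> positivity
    · dsimp only
      rw [tsum_eq_sum (s := range N) (fun n hn => if_neg (show ¬ (n + 2 ≤ N) by rw [mem_range] at hn; omega))]
      calc ∑ n ∈ range N, (if n + 2 ≤ N then ((1 : ℝ) / 2) ^ N else 0)
          ≤ ∑ n ∈ range N, ((1 : ℝ) / 2) ^ N :=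
            sum_le_sum fun n _ => by split_ifs <;> first | exact le_rfl | positivity
        _ = (N : ℝ) ^ 1 * ((1 : ℝ) / 2) ^ N := by rw [sum_const, card_range, nsmul_eq_mul, pow_one]

/-- The double family `(N, n) ↦ [X^N]â_n·2^N` is summable in `ℚ₂`. -/
theorem summable_evTerm_aHat : Summable fun p : ℕ × ℕ => evTerm (aHat p.2) p.1 :=
  Summable.of_norm_bounded summable_bound fun p => norm_evTerm_aHat_le p.2 p.1

/-- **`Σ_N φ_N 2^N = 8ξ`:** the double family summed over `n` first (finite; `Σ_{n ≤ N}[X^N]â_n = φ_N` by `Â = Φ`) and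
over `N` first (`Σ_N [X^N]â_n 2^N = t_n/(n+½)`, then `Σ_n t_n/(n+½) = 8ξ`). -/
theorem hasSum_phiCoeff : HasSum (fun N => ((phiCoeff N : ℚ) : ℚ_[2]) * 2 ^ N) (8 * xi) := by
  have hF := summable_evTerm_aHat.hasSum
  -- over `N` first, for fixed `n`
  have hswap : HasSum (fun p : ℕ × ℕ => evTerm (aHat p.1) p.2) (∑' p : ℕ × ℕ, evTerm (aHat p.2) p.1) :=
    (Equiv.prodComm ℕ ℕ).hasSum_iff.mpr hF
  have h1 : HasSum (fun n => ((xiTerm n : ℚ) : ℚ_[2])) (∑' p : ℕ × ℕ, evTerm (aHat p.2) p.1) :=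
    hswap.prod_fiberwise fun n => hasSum_evTerm_aHat n
  have htot : ∑' p : ℕ × ℕ, evTerm (aHat p.2) p.1 = 8 * xi := h1.unique hasSum_xi
  -- over `n` first, for fixed `N`
  have h2 : HasSum (fun N => ∑ n ∈ range (N + 1), evTerm (aHat n) N) (∑' p : ℕ × ℕ, evTerm (aHat p.2) p.1) :=
    hF.prod_fiberwise fun N => hasSum_sum_of_ne_finset_zero (s := range (N + 1)) fun n hn => by
      show evTerm (aHat n) N = 0
      rw [evTerm, coeff_aHat_of_lt (by rw [mem_range] at hn; omega), Rat.cast_zero, zero_mul]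
  rw [htot] at h2
  have e : (fun N => ((phiCoeff N : ℚ) : ℚ_[2]) * 2 ^ N) = fun N => ∑ n ∈ range (N + 1), evTerm (aHat n) N := by
    funext N
    rw [← sum_coeff_aHat N, Rat.cast_sum, sum_mul]
    rfl
  rw [e]
  exact h2

/-! ### Conclusion: `8ξ = Σ_{k≥1} G_k(−2)^{k+1} = −Θ₂(½)` -/

/-- **Kernel K5b (Genocchi form):** `Σ_{k≥0} G_k·(−2)^{k+1} = 8ξ` in `ℚ₂` (`G_k = 2(1−2^k)B_k`; the `k = 0` term is `0`). -/
theorem hasSum_genocchi : HasSum (fun k => ((genocchi k * (-2) ^ (k + 1) : ℚ) : ℚ_[2])) (8 * xi) := by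
  have h := (hasSum_nat_add_iff' 1).mpr hasSum_phiCoeff
  simp only [sum_range_one, phiCoeff_zero, Rat.cast_zero, zero_mul, sub_zero] at h
  have e : (fun k => ((genocchi k * (-2) ^ (k + 1) : ℚ) : ℚ_[2])) =
      fun k => ((phiCoeff (k + 1) : ℚ) : ℚ_[2]) * 2 ^ (k + 1) := by
    funext k; rw [phiCoeff_succ, show (-2 : ℚ) = (-1) * 2 by norm_num, mul_pow]; push_cast; ring
  rw [e]
  exact h

/-- The Genocchi series is summable in `ℚ₂` (a by-product of the rearrangement; no 2-adic estimate of `B_k` is used). -/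
theorem summable_genocchi : Summable fun k => ((genocchi k * (-2) ^ (k + 1) : ℚ) : ℚ_[2]) :=
  hasSum_genocchi.summable

/-- **Kernel K5b:** `8·ξ = Σ'_{k≥0} G_k·(−2)^{k+1}` in `ℚ₂`. -/
theorem eight_mul_xi_eq_tsum_genocchi : 8 * xi = ∑' k : ℕ, ((genocchi k * (-2) ^ (k + 1) : ℚ) : ℚ_[2]) :=
  hasSum_genocchi.tsum_eq.symm

/-- **Kernel K5b — `8ξ = −Θ₂(½)` (Bernoulli form):** with Beukers' `Θ₂(x) := Σ_k (2^{k+1}−2)·B_k·(−1/x)^{k+1}` at `x = ½`,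
`8·ξ = −Σ'_{k≥0} (2^{k+1}−2)·B_k·(−2)^{k+1}` in `ℚ₂` (`B_k` = Mathlib's `bernoulli`, `B₁ = −½`).  Together with [Be08, Prop. 9]
(`Θ₂(½) = −8ζ₂(2)`, paper-grade, NOT claimed here) this is the identification `ξ = ζ₂(2)` of the paper's (C6). -/
theorem eight_mul_xi_eq_neg_tsum_bernoulli :
    8 * xi = -(∑' k : ℕ, ((((2 : ℚ) ^ (k + 1) - 2) * bernoulli k * (-2) ^ (k + 1) : ℚ) : ℚ_[2])) := by
  have h := hasSum_genocchi.neg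
  have e : (fun k => -(((genocchi k * (-2) ^ (k + 1) : ℚ) : ℚ_[2]))) =
      fun k => ((((2 : ℚ) ^ (k + 1) - 2) * bernoulli k * (-2) ^ (k + 1) : ℚ) : ℚ_[2]) := by
    funext k; rw [genocchi]; push_cast; ring
  rw [e] at h
  rw [h.tsum_eq, neg_neg]

/-- Sanity (kernel arithmetic): the first Genocchi terms `G_k(−2)^{k+1}` for `k = 1, 2, 4` are `4, 8, −32`
(and `Σ_μ t_μ/(μ+½)` starts `4 + 8/9 + 32/75 + …`; both series agree 2-adically, cf. the 421-bit check in the seat's notes). -/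
example : genocchi 1 * (-2 : ℚ) ^ 2 = 4 ∧ genocchi 2 * (-2 : ℚ) ^ 3 = 8 ∧ genocchi 4 * (-2 : ℚ) ^ 5 = -32 := by
  rw [CatalanTwoAdicGenocchi.genocchi_one, CatalanTwoAdicGenocchi.genocchi_two, CatalanTwoAdicGenocchi.genocchi_four]
  norm_num

end Summit.KontsevichZagierPeriods.Zeta5Search.CatalanTwoAdicTheta

end
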